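import Summits.BirchSwinnertonDyer.Rank1Residual.GaloisImage.KolyvaginFiniteSingularLocalGlue
import Summits.BirchSwinnertonDyer.Rank1Residual.GaloisImage.CyclotomicLevelInertiaGenerators
import Literature.NumberTheory.Automorphic.BCDTTheoremBWildAtThreeCases
import Literature.NumberTheory.GaloisRepresentations.IntegralGaloisActionProofs
import Literature.NumberTheory.EllipticCurves.DeligneSerreWeightOneIrreducibleFrobeniusProofs
import HarnessLib

/-!
# The finite–singular glue from ONE Frobenius lift; the comparison operator is blind to inertia;
# an arithmetic Frobenius inside `Gal(ℚ̄/ℚ(μ_q))`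
# (cell `b2b-bsdres`, n1011 p11 GEN 10; row T-DER, file C5b-α; sequel of C5a
# `KolyvaginFiniteSingularLocalGlue`)

HONEST FRAMING (cell `b2b-bsdres`, run/shared/lean/b2b/bsd-rank1-residual/, verbatim in every
file): the goal of the cell is to DELETE the COMBINATION-SHAPED residual classes of the
Birch–Swinnerton-Dyer formula for ALL analytic-rank `≤ 1` elliptic curves over `ℚ` — "full BSD
formula for every rank `≤ 1` curve in class `C`" assembled STRICTLY from published theorems — so
that the rank-`≤ 1` remainder becomes exactly the CONSTRUCTION-SHAPED classes, which are TYPED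
(missing-input `Prop`s), NOT attempted. This is not "finishing BSD". Team n1011: research route on
the CONSTRUCTION-SHAPED class X4 / §I N11 (route-1 PORT, (P-DER)); TOOL theorems of Galois
cohomology; no definition, no named fact, no `sorry`.

## What

C5a (`Derivative.FS.singularLocalization_eq_fsLocalization_of_forall_apply_eq`) derives the
`fs_rel` clause `loc^s_𝔮 [Φ] = φ^{fs}_𝔮 (loc_𝔮 [Φ_r])` of `KolyvaginDatum.IsKolyvaginSystem` from the
COCYCLE FORM of the finite–singular relation, `Φ(τ) = Q(φ⁻¹)·Φ_r(φ)` demanded for EVERY arithmetic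
Frobenius `φ` at `𝔓₀ = adicCompletionPrime K 𝔮`.  THEOREM C of row T-DER (E3/E4b
`Derivative.Rat.apply_eq_aeval_apply_of_mem_inertia_of_eulerSystem`) supplies the cocycle form at a
Frobenius `φ` FIXING `μ_q` (`hφq : φ ∈ Gal(ℚ̄/ℚ(μ_q))`).  This file removes the gap:
* §1 (any field `F`): for `u` acting trivially on `M`, `zmodEnd`, `comparisonP`, `comparisonQ`
  and `comparisonOp` of `u·φ` and of `φ·u` are those of `φ` (Rubin's `P(x) = det(1 − φx | M)` and
  `Q(φ⁻¹)` only see the action of `φ` on the unramified module);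
* §2 (any number field `K`): **`singularLocalization_eq_fsLocalization_of_apply_eq`** = C5a with
  its hypothesis `hΦ` weakened to ONE arithmetic Frobenius `φ₁` at `𝔓₀` — two Frobenii at `𝔓₀`
  differ by an element of `I_{𝔓₀}` (Mathlib `IsArithFrobAt.mul_inv_mem_inertia`), which acts
  trivially on `M` (`hI`) and is killed by `Φ_r` (`hΦr`);
* §3 (`K = ℚ`): at every prime `𝔔 ∣ q` of `ℤ̄` there is an arithmetic Frobenius `φ ∈ Γ_ℚ` lying
  in `Gal(ℚ̄/ℚ(μ_{q′}))` (`Rat.exists_isArithFrobAt_mem_rootsOfUnityFixer`: multiply any Frobenius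
  by an inertia element of inverse mod-`q′` cyclotomic character — `ℚ(μ_{q′})/ℚ` is totally
  ramified at `q′`; tree `exists_mem_inertia_modNCyclotomicCharacter_eq_of_mem_primesAbove`,
  `isArithFrobAt_mul_of_mem_inertia`), and `σ⁻¹τ ∈ Gal(ℚ̄/ℚ(μ_N))` when `χ_N(σ) = χ_N(τ)`.
0 defs, 0 facts.  References: K. Rubin, PCMI 18 (2011), Def. 1.9.6 (independence of the lifts);
B. Mazur, K. Rubin, Mem. AMS 799 (2004), Def. 1.2.2; J. Neukirch, *Algebraic Number Theory*,
Ch. I §9 (9.4)–(9.5), Ch. II (9.6).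
-/

noncomputable section

open Field IsDedekindDomain Polynomial
open scoped NumberField
open Literature.NumberTheory.GaloisRepresentations
open Literature.NumberTheory.GaloisRepresentations.DiscreteGaloisModule
open Literature.NumberTheory.GaloisRepresentations.IsNonarchimedeanLocalField
open Literature.NumberTheory.GaloisCohomology

universe u

/-! ## §1 The comparison operator does not see inertia -/

namespace Literature.NumberTheory.GaloisRepresentations.DiscreteGaloisModule

section Blind

variable {F : Type u} [Field F] {M : Type u} [AddCommGroup M] [TopologicalSpace M]
  [DiscreteTopology M] (ρ : DiscreteGaloisModule F M) (N : ℕ) [Module (ZMod N) M]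

/-- If `u` acts trivially on `M` then so does `u⁻¹`. [folklore] -/
theorem apply_inv_eq_self_of_forall_apply_eq {u : absoluteGaloisGroup F} (hu : ∀ w : M, ρ u w = w)
    (w : M) : ρ u⁻¹ w = w := by
  have h := hu (ρ u⁻¹ w)
  rw [← Module.End.mul_apply, ← map_mul, mul_inv_cancel, map_one, Module.End.one_apply] at h
  exact h.symm

/-- `zmodEnd N (φ u) = zmodEnd N φ` when `u` acts trivially. [folklore] -/
theorem zmodEnd_mul_eq_of_forall_apply_eq (φ : absoluteGaloisGroup F) {u : absoluteGaloisGroup F}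
    (hu : ∀ w : M, ρ u w = w) : ρ.zmodEnd N (φ * u) = ρ.zmodEnd N φ := by
  refine LinearMap.ext fun w => ?_
  rw [zmodEnd_apply, zmodEnd_apply, map_mul, Module.End.mul_apply, hu]

/-- `zmodEnd N (u φ) = zmodEnd N φ` when `u` acts trivially. [folklore] -/
theorem zmodEnd_mul_eq_of_forall_apply_eq_left (φ : absoluteGaloisGroup F)
    {u : absoluteGaloisGroup F} (hu : ∀ w : M, ρ u w = w) :
    ρ.zmodEnd N (u * φ) = ρ.zmodEnd N φ := by
  refine LinearMap.ext fun w => ?_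
  rw [zmodEnd_apply, zmodEnd_apply, map_mul, Module.End.mul_apply, hu]

variable [Module.Free (ZMod N) M] [Module.Finite (ZMod N) M]

/-- **`P_{φu} = P_φ`**: Rubin's `P(x) = det(1 − φx | M)` is unchanged by an element acting
trivially on `M` (e.g. inertia on an unramified module). [cite: Rubin2011, Def. 1.9.6 (p. 14)] -/
theorem comparisonP_mul_eq_of_forall_apply_eq (φ : absoluteGaloisGroup F)
    {u : absoluteGaloisGroup F} (hu : ∀ w : M, ρ u w = w) :
    ρ.comparisonP N (φ * u) = ρ.comparisonP N φ := by
  rw [comparisonP_def, comparisonP_def, zmodEnd_mul_eq_of_forall_apply_eq ρ N φ hu]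

/-- **`P_{uφ} = P_φ`** (left version). [cite: Rubin2011, Def. 1.9.6 (p. 14)] -/
theorem comparisonP_mul_eq_of_forall_apply_eq_left (φ : absoluteGaloisGroup F)
    {u : absoluteGaloisGroup F} (hu : ∀ w : M, ρ u w = w) :
    ρ.comparisonP N (u * φ) = ρ.comparisonP N φ := by
  rw [comparisonP_def, comparisonP_def, zmodEnd_mul_eq_of_forall_apply_eq_left ρ N φ hu]

/-- **`Q_{φu}(·) = Q_φ(·)`** and the OPERATOR `Q_{φu}((φu)⁻¹) = Q_φ(φ⁻¹)` when `u` acts trivially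
on `M`: the finite–singular comparison operator is independent of the Frobenius lift.
[cite: Rubin2011, Def. 1.9.6 (p. 14)] [cite: Kim2022StructureSelmer, §2.1.2] -/
theorem comparisonOp_mul_eq_of_forall_apply_eq (φ : absoluteGaloisGroup F)
    {u : absoluteGaloisGroup F} (hu : ∀ w : M, ρ u w = w) :
    ρ.comparisonOp N (φ * u) = ρ.comparisonOp N φ := by
  rw [comparisonOp_def, comparisonOp_def, comparisonQ, comparisonQ,
    comparisonP_mul_eq_of_forall_apply_eq ρ N φ hu, mul_inv_rev,
    zmodEnd_mul_eq_of_forall_apply_eq_left ρ N φ⁻¹ (apply_inv_eq_self_of_forall_apply_eq ρ hu)]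

/-- The operator `Q(φ⁻¹)` for `uφ` is that of `φ` when `u` acts trivially on `M` (left version).
[cite: Rubin2011, Def. 1.9.6 (p. 14)] [cite: Kim2022StructureSelmer, §2.1.2] -/
theorem comparisonOp_mul_eq_of_forall_apply_eq_left (φ : absoluteGaloisGroup F)
    {u : absoluteGaloisGroup F} (hu : ∀ w : M, ρ u w = w) :
    ρ.comparisonOp N (u * φ) = ρ.comparisonOp N φ := by
  rw [comparisonOp_def, comparisonOp_def, comparisonQ, comparisonQ,
    comparisonP_mul_eq_of_forall_apply_eq_left ρ N φ hu, mul_inv_rev,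
    zmodEnd_mul_eq_of_forall_apply_eq ρ N φ⁻¹ (apply_inv_eq_self_of_forall_apply_eq ρ hu)]

end Blind

end Literature.NumberTheory.GaloisRepresentations.DiscreteGaloisModule

/-! ## §2 The local–global glue from ONE arithmetic Frobenius at `𝔓₀` -/

namespace Summit.BirchSwinnertonDyer.Rank1Residual.GaloisImage.Derivative.FS

variable {K : Type u} [Field K] [NumberField K]
variable {M : Type u} [AddCommGroup M] [TopologicalSpace M] [DiscreteTopology M]
variable (ρ : DiscreteGaloisModule K M) (N : ℕ) [Module (ZMod N) M] [Module.Free (ZMod N) M]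
  [Module.Finite (ZMod N) M]

omit [NumberField K] in
/-- **An unramified cocycle takes the same value at all Frobenius lifts**: if `ρ` is unramified at
`𝔓` (`hI`) and `Φ_r(I_𝔓) = 0`, then `Φ_r(uφ) = Φ_r(φ)` for `u ∈ I_𝔓`. [folklore] -/
theorem apply_mul_eq_of_mem_inertia {𝔓 : Ideal (absIntegers (𝓞 K) K)}
    (hI : ∀ τ ∈ 𝔓.inertia (absoluteGaloisGroup K), ∀ w : M, ρ τ w = w)
    (Φr : contOneCocycles ρ.toTopRep)
    (hΦr : ∀ τ ∈ 𝔓.inertia (absoluteGaloisGroup K), Φr.1 τ = 0)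
    {u : absoluteGaloisGroup K} (hu : u ∈ 𝔓.inertia (absoluteGaloisGroup K))
    (φ : absoluteGaloisGroup K) : Φr.1 (u * φ) = Φr.1 φ := by
  rw [Φr.2, hΦr u hu, zero_add]
  exact hI u hu _

/-- **The local–global glue for the finite–singular relation, from ONE Frobenius lift.**  As C5a
`singularLocalization_eq_fsLocalization_of_forall_apply_eq` (see its docstring), but the
cocycle-form relation `Φ(τ) = Q(φ₁⁻¹)·Φ_r(φ₁)` (all `τ ∈ I_{𝔓₀}` with `χ_{N𝔮}(τ) = η_𝔮`) is asked at
a SINGLE arithmetic Frobenius `φ₁` at `𝔓₀ = adicCompletionPrime K 𝔮`: any other Frobenius at `𝔓₀`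
is `uφ₁` with `u ∈ I_{𝔓₀}` (Mathlib `IsArithFrobAt.mul_inv_mem_inertia`), and both `Q(·⁻¹)` (§1)
and `Φ_r` (unramified) are blind to `u`.  Conclusion: **`loc^s_𝔮 [Φ] = φ^{fs}_𝔮 (loc_𝔮 [Φ_r])`**.
[cite: Rubin2011, Def. 1.9.6 (p. 14)] [cite: MazurRubin2004, Def. 1.2.2]
[cite: Kim2022StructureSelmer, §2.1.2–§2.2.2] -/
theorem singularLocalization_eq_fsLocalization_of_apply_eq (D : KolyvaginDatum ρ)
    {η : (q : HeightOneSpectrum (𝓞 K)) → (ZMod (Ideal.absNorm q.asIdeal))ˣ}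
    (hD : D.HasCanonicalComparison N η) {q : HeightOneSpectrum (𝓞 K)} (hq : q ∈ D.primes)
    (hI : ∀ τ ∈ (adicCompletionPrime K q).inertia (absoluteGaloisGroup K), ∀ w : M, ρ τ w = w)
    (Φ Φr : contOneCocycles ρ.toTopRep)
    (hΦr : ∀ τ ∈ (adicCompletionPrime K q).inertia (absoluteGaloisGroup K), Φr.1 τ = 0)
    {φ₁ : absoluteGaloisGroup K} (hφ₁ : IsArithFrobAt (𝓞 K) φ₁ (adicCompletionPrime K q))
    (hΦ : ∀ τ ∈ (adicCompletionPrime K q).inertia (absoluteGaloisGroup K),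
      modNCyclotomicCharacter K (Ideal.absNorm q.asIdeal) τ = η q →
        Φ.1 τ = ρ.comparisonOp N φ₁ (Φr.1 φ₁))
    {τ₀ : absoluteGaloisGroup (q.adicCompletion K)} (hτ₀I : τ₀ ∈ absInertia (q.adicCompletion K))
    (hτ₀ : localNormCyclotomicCharacter q τ₀ = η q) :
    KolyvaginDatum.singularLocalization ρ q (oneCocycleClass ρ.toTopRep Φ) =
      D.fsLocalization q (oneCocycleClass ρ.toTopRep Φr) := by
  refine singularLocalization_eq_fsLocalization_of_forall_apply_eq ρ N D hD hq hI Φ Φr hΦr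
    (fun φ hφ τ hτ hχ => ?_) hτ₀I hτ₀
  -- `φ = u φ₁` with `u ∈ I_{𝔓₀}`
  have hu : φ * φ₁⁻¹ ∈ (adicCompletionPrime K q).inertia (absoluteGaloisGroup K) :=
    hφ.mul_inv_mem_inertia hφ₁
  have hφeq : φ = φ * φ₁⁻¹ * φ₁ := by rw [inv_mul_cancel_right]
  have hI' : ∀ w : M, ρ (φ * φ₁⁻¹) w = w := hI _ hu
  rw [hΦ τ hτ hχ, hφeq, apply_mul_eq_of_mem_inertia ρ hI Φr hΦr hu φ₁,
    comparisonOp_mul_eq_of_forall_apply_eq_left ρ N φ₁ hI']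

end Summit.BirchSwinnertonDyer.Rank1Residual.GaloisImage.Derivative.FS

/-! ## §3 Over `ℚ`: an arithmetic Frobenius fixing `μ_{q′}`; inertia lifts of one generator -/

namespace Summit.BirchSwinnertonDyer.Rank1Residual.GaloisImage.CyclotomicLevel.Rat

open Rat.HeightOneSpectrum

/-- **An arithmetic Frobenius at `𝔔 ∣ q` inside `Gal(ℚ̄/ℚ(μ_{q′}))`.**  For a finite place `q`
of `ℚ` (prime `q′`) and a prime `𝔔 ∣ q` of `ℤ̄` there is `φ ∈ Γ_ℚ`, an arithmetic Frobenius at `𝔔`,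
with `φ ∈ rootsOfUnityFixer ℚ q′`: take any Frobenius `φ₀` at `𝔔` and `u ∈ I_𝔔` with
`χ_{q′}(u) = χ_{q′}(φ₀)⁻¹` (`ℚ(μ_{q′})/ℚ` is totally ramified at `q′`); `φ = φ₀ u`.  This is the
binder `hφq` of THEOREM C (`Derivative.Rat.apply_sigma_eq_aeval_apply_of_eulerSystem`).
Neukirch, *Algebraic Number Theory*, Ch. I §9–§10. [folklore] -/
theorem exists_isArithFrobAt_mem_rootsOfUnityFixer (q : HeightOneSpectrum (𝓞 ℚ))
    {𝔔 : Ideal (absIntegers (𝓞 ℚ) ℚ)} (h𝔔 : 𝔔 ∈ q.primesAbove) :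
    ∃ φ : absoluteGaloisGroup ℚ, IsArithFrobAt (𝓞 ℚ) φ 𝔔 ∧
      φ ∈ rootsOfUnityFixer ℚ ((primesEquiv q : Nat.Primes) : ℕ) := by
  haveI : NeZero ((primesEquiv q : Nat.Primes) : ℕ) := ⟨(primesEquiv q).2.ne_zero⟩
  haveI := h𝔔.1
  obtain ⟨φ₀, hφ₀⟩ := HeightOneSpectrum.exists_isArithFrobAt_of_mem_primesAbove_holds (K := ℚ) (v := q) h𝔔
  obtain ⟨u, huI, huχ⟩ := exists_mem_inertia_modNCyclotomicCharacter_eq_of_mem_primesAbove q h𝔔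
    (modNCyclotomicCharacter ℚ ((primesEquiv q : Nat.Primes) : ℕ) φ₀)⁻¹
  refine ⟨φ₀ * u, isArithFrobAt_mul_of_mem_inertia hφ₀ huI, ?_⟩
  rw [rootsOfUnityFixer_eq_ker, MonoidHom.mem_ker, map_mul, huχ, mul_inv_cancel]

/-- **An arithmetic Frobenius at `𝔔 ∣ q` in the tame level `Gal(ℚ̄/ℚ(μ_{q′}))` of
`cyclotomicLevelsRat p S`** (THEOREM C's `hφq`). [folklore] -/
theorem exists_isArithFrobAt_mem_tameLevel (p : ℕ) [Fact p.Prime]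
    (S : Set (HeightOneSpectrum (𝓞 ℚ))) (q : HeightOneSpectrum (𝓞 ℚ))
    {𝔔 : Ideal (absIntegers (𝓞 ℚ) ℚ)} (h𝔔 : 𝔔 ∈ q.primesAbove) :
    ∃ φ : absoluteGaloisGroup ℚ, IsArithFrobAt (𝓞 ℚ) φ 𝔔 ∧
      φ ∈ (cyclotomicLevelsRat p S).tameLevel q := by
  obtain ⟨φ, hφ, hφq⟩ := exists_isArithFrobAt_mem_rootsOfUnityFixer q h𝔔
  exact ⟨φ, hφ, by rw [cyclotomicLevelsRat_tameLevel]; exact hφq⟩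

/-- **Two elements with the same mod-`N` cyclotomic character differ by an element of
`Gal(ℚ̄/ℚ(μ_N))`**: `χ_N(σ) = χ_N(τ) ⟹ σ⁻¹τ ∈ rootsOfUnityFixer ℚ N` — the binder `hτσ` of E4b
`Derivative.Rat.apply_eq_aeval_apply_of_mem_inertia_of_eulerSystem` for an inertia lift `τ` of the
generator `σ_q`. [folklore] -/
theorem inv_mul_mem_rootsOfUnityFixer_of_modNCyclotomicCharacter_eq {N : ℕ} [NeZero N]
    {σ τ : absoluteGaloisGroup ℚ}
    (h : modNCyclotomicCharacter ℚ N σ = modNCyclotomicCharacter ℚ N τ) :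
    σ⁻¹ * τ ∈ rootsOfUnityFixer ℚ N := by
  rw [rootsOfUnityFixer_eq_ker, MonoidHom.mem_ker, map_mul, map_inv, h, inv_mul_cancel]

/-- The same in the tame level `Gal(ℚ̄/ℚ(μ_{q′}))` of `cyclotomicLevelsRat p S`, with the character
taken mod `N𝔮 = absNorm q` (the currency of `KolyvaginDatum.HasCanonicalComparison`; over `ℚ`,
`N𝔮 = q′`, tree `LFunctions.absNorm_asIdeal_eq_primesEquiv`). [folklore] -/
theorem inv_mul_mem_tameLevel_of_modNCyclotomicCharacter_absNorm_eq (p : ℕ) [Fact p.Prime]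
    (S : Set (HeightOneSpectrum (𝓞 ℚ))) (q : HeightOneSpectrum (𝓞 ℚ))
    {σ τ : absoluteGaloisGroup ℚ}
    (h : modNCyclotomicCharacter ℚ (Ideal.absNorm q.asIdeal) σ =
      modNCyclotomicCharacter ℚ (Ideal.absNorm q.asIdeal) τ) :
    σ⁻¹ * τ ∈ (cyclotomicLevelsRat p S).tameLevel q := by
  rw [cyclotomicLevelsRat_tameLevel,
    ← Literature.NumberTheory.LFunctions.absNorm_asIdeal_eq_primesEquiv q]
  exact inv_mul_mem_rootsOfUnityFixer_of_modNCyclotomicCharacter_eq h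

end Summit.BirchSwinnertonDyer.Rank1Residual.GaloisImage.CyclotomicLevel.Rat

end
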